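import Summits.QuantumFields.YangMills.Theorems.LuscherReductionRunningReductionInnerPhase
import Summits.QuantumFields.YangMills.Theorems.LuscherReductionRunningReductionLatticeLargeField
import Summits.QuantumFields.YangMills.Theorems.LuscherReductionRunningReductionLatticeTopLower
import Summits.QuantumFields.YangMills.Theorems.LuscherReductionOneSiteLevelsActionLipschitz
import HarnessLib

/-!
# The three-region decomposition of the zero-flux transfer form on `(ℤ/L)³`: INNER + VALLEY + LARGE FIELD, with the large-field piece
# already bounded (sub-stub C2d of the fixed-lattice programme COARSE(L₀) — route `LuscherReduction`, crux RED stmt-QuantumFields-19978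
# KT-door 3b′ / crux `TwistedTraceScaling` stmt-QuantumFields-20203 S-BASE; design note `pub/ym-fleet/ym-luscher-20007-p1/COARSE-DESIGN.md` §2)

A second IMS phase, in the magnetic energy: `actionPhase η U = (π/2)(1 − bump (S(U)/(2η)))` (`= 0` where `S ≤ η`, `= π/2` where `S ≥ 2η`;
gauge- and twist-invariant because `S` is; link-Lipschitz because `S` is: `abs_wilsonAction_sub_le_lat`,
`|S(U) − S(V)| ≤ 8|P| Σ_e ‖U_e − V_e‖_F`).  Applied to the OUTER piece `φ = sin Θ_δ · ψ` of `qform_le_inner_outer_lat` and combined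
with the large-field suppression (`qform_le_exp_neg_of_action_ge_lat`) it yields the ONION THEOREM

  ★ `qform_le_three_regions_lat`:  for `β > 0`, `δ > 0`, `η > 0` and every physical zero-flux `ψ` on the `L³` torus,
    `⟨ψ,Kψ⟩ ≤ ⟨ψ_in, K ψ_in⟩ + ⟨ψ_val, K ψ_val⟩ + (e^{−βη} + ½|E|²(3/β)((8π/δ)² + (4π|P|/η)²))·c_β^{|E|}·‖ψ‖²`,
    `ψ_in = cos Θ_δ · ψ` (supported in `{S ≤ 8δ²|P|}`, `…InnerRegion`), `ψ_val = cos Θ'_η · (sin Θ_δ · ψ)` (supported in the VALLEY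
    `{S < 2η} ∩ {∀ z, orbitDist (twist3 z U) > δ/2}`: `valley_support`), both physical (`isPhys_inner`, `isPhys_valley`).

So COARSE-UPPER(L₁) is reduced to two genuinely semiclassical bounds: the INNER Born–Oppenheimer comparison (C4) and the VALLEY gain (C3).
HONEST FRAMING: localisation bookkeeping; C3/C4 are OPEN; femto rung R2b1; not a gap, not Clay.
-/

set_option autoImplicit false

noncomputable section

open MeasureTheory Filter Topology Real
open scoped Matrix ComplexConjugate BigOperators
open Literature.MathematicalPhysics.QuantumFieldTheory
open Literature.MathematicalPhysics.QuantumLattice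

namespace Summit.QuantumFields.YangMills.Theorems.FemtoTransferGap

variable {L : ℕ} [NeZero L]

/-! ## §1 The Wilson action is link-Lipschitz on the torus -/

/-- `‖XY − X'Y'‖_F ≤ ‖X − X'‖_F + ‖Y − Y'‖_F` on `SU(2)` (`XY − X'Y' = X(Y − Y') + (X − X')Y'`). [folklore] -/
theorem frobNorm_mul_sub_mul_le (X Y X' Y' : SU2) :
    frobNorm (((X * Y : SU2) : Matrix (Fin 2) (Fin 2) ℂ) - ((X' * Y' : SU2) : Matrix (Fin 2) (Fin 2) ℂ)) ≤
      frobNorm ((X : Matrix (Fin 2) (Fin 2) ℂ) - (X' : Matrix (Fin 2) (Fin 2) ℂ)) +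
        frobNorm ((Y : Matrix (Fin 2) (Fin 2) ℂ) - (Y' : Matrix (Fin 2) (Fin 2) ℂ)) := by
  have e : ((X * Y : SU2) : Matrix (Fin 2) (Fin 2) ℂ) - ((X' * Y' : SU2) : Matrix (Fin 2) (Fin 2) ℂ) =
      (X : Matrix (Fin 2) (Fin 2) ℂ) * ((Y : Matrix (Fin 2) (Fin 2) ℂ) - (Y' : Matrix (Fin 2) (Fin 2) ℂ)) +
        ((X : Matrix (Fin 2) (Fin 2) ℂ) - (X' : Matrix (Fin 2) (Fin 2) ℂ)) * (Y' : Matrix (Fin 2) (Fin 2) ℂ) := by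
    rw [Submonoid.coe_mul, Submonoid.coe_mul, Matrix.mul_sub, Matrix.sub_mul]; abel
  rw [e]
  refine (frobNorm_add_le' _ _).trans ?_
  rw [frobNorm_unitary_mul (su2_mem_unitaryGroup X), frobNorm_mul_unitary _ (su2_mem_unitaryGroup Y'), add_comm]

/-- A plaquette holonomy moves by at most `4 Σ_e ‖U_e − V_e‖_F` (each of its four links by at most the total). [folklore] -/
theorem frobNorm_plaquetteHolonomy_sub_le (U V : GaugeConfig 3 L SU2) (x : Site 3 L) (i j : Fin 3) :
    frobNorm (((plaquetteHolonomy U x i j : SU2) : Matrix (Fin 2) (Fin 2) ℂ) - ((plaquetteHolonomy V x i j : SU2) : Matrix (Fin 2) (Fin 2) ℂ))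
      ≤ 4 * ∑ e : Edge 3 L, frobNorm (((U e : SU2) : Matrix (Fin 2) (Fin 2) ℂ) - ((V e : SU2) : Matrix (Fin 2) (Fin 2) ℂ)) := by
  have hDle : ∀ e : Edge 3 L, frobNorm (((U e : SU2) : Matrix (Fin 2) (Fin 2) ℂ) - ((V e : SU2) : Matrix (Fin 2) (Fin 2) ℂ)) ≤
      ∑ e', frobNorm (((U e' : SU2) : Matrix (Fin 2) (Fin 2) ℂ) - ((V e' : SU2) : Matrix (Fin 2) (Fin 2) ℂ)) := fun e =>
    Finset.single_le_sum (f := fun e' => frobNorm (((U e' : SU2) : Matrix (Fin 2) (Fin 2) ℂ) - ((V e' : SU2) : Matrix (Fin 2) (Fin 2) ℂ)))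
      (fun e' _ => frobNorm_nonneg _) (Finset.mem_univ e)
  unfold plaquetteHolonomy
  have h1 := frobNorm_mul_sub_mul_le (U (x, i) * U (x.shift i, j) * (U (x.shift j, i))⁻¹) (U (x, j))⁻¹
    (V (x, i) * V (x.shift i, j) * (V (x.shift j, i))⁻¹) (V (x, j))⁻¹
  have h2 := frobNorm_mul_sub_mul_le (U (x, i) * U (x.shift i, j)) (U (x.shift j, i))⁻¹ (V (x, i) * V (x.shift i, j)) (V (x.shift j, i))⁻¹
  have h3 := frobNorm_mul_sub_mul_le (U (x, i)) (U (x.shift i, j)) (V (x, i)) (V (x.shift i, j))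
  rw [frobNorm_inv_sub_inv] at h1 h2
  linarith [hDle (x, i), hDle (x.shift i, j), hDle (x.shift j, i), hDle (x, j)]

/-- One plaquette term moves by at most `8 Σ_e ‖U_e − V_e‖_F` (`|Re tr X| ≤ 2‖X‖_F`). [folklore] -/
theorem abs_plaquetteTerm_sub_le (U V : GaugeConfig 3 L SU2) (x : Site 3 L) (i j : Fin 3) :
    |(2 - ((su2Rep (plaquetteHolonomy U x i j)).trace).re) - (2 - ((su2Rep (plaquetteHolonomy V x i j)).trace).re)| ≤
      8 * ∑ e : Edge 3 L, frobNorm (((U e : SU2) : Matrix (Fin 2) (Fin 2) ℂ) - ((V e : SU2) : Matrix (Fin 2) (Fin 2) ℂ)) := by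
  rw [fundamentalRep_apply, fundamentalRep_apply]
  have e : (2 - ((plaquetteHolonomy U x i j : SU2) : Matrix (Fin 2) (Fin 2) ℂ).trace.re) -
      (2 - ((plaquetteHolonomy V x i j : SU2) : Matrix (Fin 2) (Fin 2) ℂ).trace.re) =
      -((((plaquetteHolonomy U x i j : SU2) : Matrix (Fin 2) (Fin 2) ℂ) -
        ((plaquetteHolonomy V x i j : SU2) : Matrix (Fin 2) (Fin 2) ℂ)).trace.re) := by
    rw [Matrix.trace_sub, Complex.sub_re]; ring
  rw [e, abs_neg]
  refine (abs_re_trace_le_two_mul_frobNorm _).trans ?_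
  linarith [frobNorm_plaquetteHolonomy_sub_le U V x i j]

/-- ★ **The Wilson action of the `L³` torus is link-Lipschitz**: `|S(U) − S(V)| ≤ 8|P| Σ_e ‖U_e − V_e‖_F`. [folklore] -/
theorem abs_wilsonAction_sub_le_lat (U V : GaugeConfig 3 L SU2) :
    |wilsonAction su2Rep U - wilsonAction su2Rep V| ≤
      8 * Fintype.card (Plaquette 3 L) *
        ∑ e : Edge 3 L, frobNorm (((U e : SU2) : Matrix (Fin 2) (Fin 2) ℂ) - ((V e : SU2) : Matrix (Fin 2) (Fin 2) ℂ)) := by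
  have h1 : wilsonAction su2Rep U - wilsonAction su2Rep V =
      ∑ p : Plaquette 3 L, ((2 - ((su2Rep (plaquetteHolonomy U p.1 p.2.1.1 p.2.1.2)).trace).re) -
        (2 - ((su2Rep (plaquetteHolonomy V p.1 p.2.1.1 p.2.1.2)).trace).re)) := by
    unfold wilsonAction
    rw [← Finset.sum_sub_distrib]
    simp
  rw [h1]
  refine (Finset.abs_sum_le_sum_abs _ _).trans ?_
  calc ∑ p : Plaquette 3 L, |(2 - ((su2Rep (plaquetteHolonomy U p.1 p.2.1.1 p.2.1.2)).trace).re) -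
          (2 - ((su2Rep (plaquetteHolonomy V p.1 p.2.1.1 p.2.1.2)).trace).re)|
      ≤ ∑ _p : Plaquette 3 L, 8 * ∑ e : Edge 3 L, frobNorm (((U e : SU2) : Matrix (Fin 2) (Fin 2) ℂ) - ((V e : SU2) : Matrix (Fin 2) (Fin 2) ℂ)) :=
        Finset.sum_le_sum fun p _ => abs_plaquetteTerm_sub_le U V _ _ _
    _ = 8 * Fintype.card (Plaquette 3 L) *
          ∑ e : Edge 3 L, frobNorm (((U e : SU2) : Matrix (Fin 2) (Fin 2) ℂ) - ((V e : SU2) : Matrix (Fin 2) (Fin 2) ℂ)) := by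
        rw [Finset.sum_const, Finset.card_univ, nsmul_eq_mul]; ring

/-! ## §2 The action phase -/

/-- **The action phase** `Θ'_η(U) = (π/2)(1 − bump (S(U)/(2η)))`: `0` where `S ≤ η`, `π/2` where `S ≥ 2η`. [cite: SimonB1983DiscreteSpectrum, §3] -/
def actionPhase (η : ℝ) (U : GaugeConfig 3 L SU2) : ℝ := (π / 2) * (1 - bump (wilsonAction su2Rep U / (2 * η)))

/-- Gauge invariance of the action phase. [folklore] -/
theorem actionPhase_gaugeTransform (η : ℝ) (g : Site 3 L → SU2) (U : GaugeConfig 3 L SU2) :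
    actionPhase η (gaugeTransform g U) = actionPhase η U := by
  unfold actionPhase; rw [wilsonAction_gaugeTransform]

/-- Twist invariance of the action phase. [cite: tHooft1979] -/
theorem actionPhase_twist (η : ℝ) (k : Fin 3) {c : SU2} (hc : c ∈ Subgroup.center SU2) (U : GaugeConfig 3 L SU2) :
    actionPhase η (twist k c U) = actionPhase η U := by
  unfold actionPhase; rw [wilsonAction_twist_of_mem_center su2Rep k hc]

/-- The action phase is measurable. [folklore] -/
theorem measurable_actionPhase (η : ℝ) : Measurable (actionPhase (L := L) η) := by
  haveI := secondCountableTopology_su2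
  unfold actionPhase
  exact measurable_const.mul (measurable_const.sub (continuous_bump.measurable.comp
    ((continuous_wilsonAction su2Rep continuous_su2Rep).measurable.div_const _)))

/-- **The action phase is link-Lipschitz**: `|Θ'_η(U) − Θ'_η(V)| ≤ (4π|P|/η) Σ_e ‖U_e − V_e‖_F` (`η > 0`). [folklore] -/
theorem abs_actionPhase_sub_le {η : ℝ} (hη : 0 < η) (U V : GaugeConfig 3 L SU2) :
    |actionPhase η U - actionPhase η V| ≤
      (4 * π * Fintype.card (Plaquette 3 L) / η) *
        ∑ e : Edge 3 L, frobNorm (((U e : SU2) : Matrix (Fin 2) (Fin 2) ℂ) - ((V e : SU2) : Matrix (Fin 2) (Fin 2) ℂ)) := by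
  set D := ∑ e : Edge 3 L, frobNorm (((U e : SU2) : Matrix (Fin 2) (Fin 2) ℂ) - ((V e : SU2) : Matrix (Fin 2) (Fin 2) ℂ)) with hD
  unfold actionPhase
  rw [← mul_sub, abs_mul, abs_of_pos (by positivity : (0 : ℝ) < π / 2),
    show (1 - bump (wilsonAction su2Rep U / (2 * η))) - (1 - bump (wilsonAction su2Rep V / (2 * η))) =
      -(bump (wilsonAction su2Rep U / (2 * η)) - bump (wilsonAction su2Rep V / (2 * η))) by ring, abs_neg]
  have h1 := abs_bump_sub_le (wilsonAction su2Rep U / (2 * η)) (wilsonAction su2Rep V / (2 * η))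
  have h2 : |wilsonAction su2Rep U / (2 * η) - wilsonAction su2Rep V / (2 * η)| ≤ 8 * Fintype.card (Plaquette 3 L) * D / (2 * η) := by
    rw [← sub_div, abs_div, abs_of_pos (by positivity : (0 : ℝ) < 2 * η)]
    exact div_le_div_of_nonneg_right (abs_wilsonAction_sub_le_lat U V) (by positivity)
  calc π / 2 * |bump (wilsonAction su2Rep U / (2 * η)) - bump (wilsonAction su2Rep V / (2 * η))|
      ≤ π / 2 * (2 * (8 * Fintype.card (Plaquette 3 L) * D / (2 * η))) := mul_le_mul_of_nonneg_left (h1.trans (by linarith)) (by positivity)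
    _ = 4 * π * Fintype.card (Plaquette 3 L) / η * D := by field_simp; ring

/-- If `sin Θ'_η(U) ≠ 0` then `S(U) > η` (`η > 0`): the `sin`-piece lives on LARGE FIELDS. [folklore] -/
theorem action_gt_of_sin_actionPhase_ne_zero {η : ℝ} (hη : 0 < η) {U : GaugeConfig 3 L SU2} (h : Real.sin (actionPhase η U) ≠ 0) :
    η < wilsonAction su2Rep U := by
  by_contra hS
  rw [not_lt] at hS
  apply h
  unfold actionPhase
  rw [bump_eq_one (by rw [div_le_iff₀ (by positivity)]; linarith), sub_self, mul_zero, Real.sin_zero]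

/-- If `cos Θ'_η(U) ≠ 0` then `S(U) < 2η` (`η > 0`): the `cos`-piece lives on SMALL FIELDS. [folklore] -/
theorem action_lt_of_cos_actionPhase_ne_zero {η : ℝ} (hη : 0 < η) {U : GaugeConfig 3 L SU2} (h : Real.cos (actionPhase η U) ≠ 0) :
    wilsonAction su2Rep U < 2 * η := by
  by_contra hS
  rw [not_lt] at hS
  apply h
  unfold actionPhase
  rw [bump_eq_zero (by rw [le_div_iff₀ (by positivity)]; linarith), sub_zero, mul_one, Real.cos_pi_div_two]

/-! ## §3 The three-region decomposition -/

/-- Multiplying a physical test function by a cut-off of modulus `≤ 1` does not increase its `L²` norm. [folklore] -/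
theorem l2_mul_le {J ψ : GaugeConfig 3 L SU2 → ℝ} (hψ : IsPhys ψ) (hJ1 : ∀ U, |J U| ≤ 1) :
    l2 (fun U => J U * ψ U) (fun U => J U * ψ U) ≤ l2 ψ ψ := by
  unfold l2
  refine integral_mono_of_nonneg (ae_of_all _ fun U => mul_self_nonneg _) (hψ.integrable_mul hψ) (ae_of_all _ fun U => ?_)
  show J U * ψ U * (J U * ψ U) ≤ ψ U * ψ U
  have hJ2 : J U ^ 2 ≤ 1 := by
    have h := hJ1 U
    rw [abs_le] at h
    nlinarith
  have : J U * ψ U * (J U * ψ U) = J U ^ 2 * (ψ U * ψ U) := by ring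
  rw [this]
  exact (mul_le_mul_of_nonneg_right hJ2 (mul_self_nonneg _)).trans (by rw [one_mul])

/-- The INNER piece `cos Θ_δ · ψ` is physical. [folklore] -/
theorem isPhys_inner (δ : ℝ) {ψ : GaugeConfig 3 L SU2 → ℝ} (hψ : IsPhys ψ) : IsPhys fun U => Real.cos (innerPhase δ U) * ψ U :=
  hψ.mul_of_invariant (Real.continuous_cos.measurable.comp (measurable_innerPhase δ)) (fun U => Real.abs_cos_le_one _)
    (fun g U => by rw [innerPhase_gaugeTransform]) (fun k c hc U => by rw [innerPhase_twist δ k hc])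

/-- The OUTER piece `sin Θ_δ · ψ` is physical. [folklore] -/
theorem isPhys_outer (δ : ℝ) {ψ : GaugeConfig 3 L SU2 → ℝ} (hψ : IsPhys ψ) : IsPhys fun U => Real.sin (innerPhase δ U) * ψ U :=
  hψ.mul_of_invariant (Real.continuous_sin.measurable.comp (measurable_innerPhase δ)) (fun U => Real.abs_sin_le_one _)
    (fun g U => by rw [innerPhase_gaugeTransform]) (fun k c hc U => by rw [innerPhase_twist δ k hc])

/-- The VALLEY piece `cos Θ'_η · φ` of a physical `φ` is physical. [folklore] -/
theorem isPhys_valley (η : ℝ) {φ : GaugeConfig 3 L SU2 → ℝ} (hφ : IsPhys φ) : IsPhys fun U => Real.cos (actionPhase η U) * φ U :=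
  hφ.mul_of_invariant (Real.continuous_cos.measurable.comp (measurable_actionPhase η)) (fun U => Real.abs_cos_le_one _)
    (fun g U => by rw [actionPhase_gaugeTransform]) (fun k c hc U => by rw [actionPhase_twist η k hc])

/-- The LARGE-FIELD piece `sin Θ'_η · φ` of a physical `φ` is physical. [folklore] -/
theorem isPhys_largeField (η : ℝ) {φ : GaugeConfig 3 L SU2 → ℝ} (hφ : IsPhys φ) : IsPhys fun U => Real.sin (actionPhase η U) * φ U :=
  hφ.mul_of_invariant (Real.continuous_sin.measurable.comp (measurable_actionPhase η)) (fun U => Real.abs_sin_le_one _)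
    (fun g U => by rw [actionPhase_gaugeTransform]) (fun k c hc U => by rw [actionPhase_twist η k hc])

/-- **Support of the VALLEY piece**: where `cos Θ'_η · (sin Θ_δ · ψ) ≠ 0` the action is `< 2η` and every twisted orbit distance is `> δ/2`.
[folklore] -/
theorem valley_support {δ η : ℝ} (hδ : 0 < δ) (hη : 0 < η) (ψ : GaugeConfig 3 L SU2 → ℝ) {U : GaugeConfig 3 L SU2}
    (h : Real.cos (actionPhase η U) * (Real.sin (innerPhase δ U) * ψ U) ≠ 0) :
    wilsonAction su2Rep U < 2 * η ∧ ∀ z : Fin 3 → Bool, δ / 2 < orbitDist (TT.twist3 z U) :=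
  ⟨action_lt_of_cos_actionPhase_ne_zero hη (left_ne_zero_of_mul h),
    forall_lt_orbitDist_of_sin_ne_zero hδ (left_ne_zero_of_mul (right_ne_zero_of_mul h))⟩

/-- ★ **The onion theorem: INNER + VALLEY + LARGE FIELD.**  For `β > 0`, `δ > 0`, `η > 0` and every physical zero-flux `ψ` on the `L³` torus,
`⟨ψ,K_βψ⟩ ≤ ⟨ψ_in,Kψ_in⟩ + ⟨ψ_val,Kψ_val⟩ + (e^{−βη} + ½|E|²(3/β)((8π/δ)² + (4π|P|/η)²))·c_β^{|E|}·‖ψ‖²`, with `ψ_in = cos Θ_δ·ψ` and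
`ψ_val = cos Θ'_η·(sin Θ_δ·ψ)`. [cite: SimonB1983DiscreteSpectrum, §3] [cite: Luscher1983, §2] -/
theorem qform_le_three_regions_lat {β : ℝ} (hβ : 0 < β) {δ : ℝ} (hδ : 0 < δ) {η : ℝ} (hη : 0 < η)
    {ψ : GaugeConfig 3 L SU2 → ℝ} (hψ : IsPhys ψ) :
    qform su2Rep β ψ ψ ≤
      qform su2Rep β (fun U => Real.cos (innerPhase δ U) * ψ U) (fun U => Real.cos (innerPhase δ U) * ψ U)
      + qform su2Rep β (fun U => Real.cos (actionPhase η U) * (Real.sin (innerPhase δ U) * ψ U))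
          (fun U => Real.cos (actionPhase η U) * (Real.sin (innerPhase δ U) * ψ U))
      + (Real.exp (-(β * η)) + (1 / 2) * ((Fintype.card (Edge 3 L) : ℝ) ^ 2 * (3 / β) *
          ((8 * π / δ) ^ 2 + (4 * π * Fintype.card (Plaquette 3 L) / η) ^ 2))) * latCE L β * l2 ψ ψ := by
  set φ : GaugeConfig 3 L SU2 → ℝ := fun U => Real.sin (innerPhase δ U) * ψ U with hφ
  have hφP : IsPhys φ := isPhys_outer δ hψ
  set χ : GaugeConfig 3 L SU2 → ℝ := fun U => Real.sin (actionPhase η U) * φ U with hχ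
  have hχP : IsPhys χ := isPhys_largeField η hφP
  -- Step A: inner/outer split
  have hA := qform_le_inner_outer_lat hβ hδ hψ
  -- Step B: action split of the outer piece
  have hB := qform_le_localized_cos_sin_lat hβ (measurable_actionPhase η) (by positivity : (0 : ℝ) ≤ 4 * π * Fintype.card (Plaquette 3 L) / η)
    (abs_actionPhase_sub_le hη) (fun g U => actionPhase_gaugeTransform η g U) (fun k c hc U => actionPhase_twist η k hc U) hφP
  -- Step C: large-field suppression of `χ`
  have hC : qform su2Rep β χ χ ≤ Real.exp (-(β * η)) * latCE L β * l2 χ χ :=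
    qform_le_exp_neg_of_action_ge_lat hβ.le hχP fun U hU => (action_gt_of_sin_actionPhase_ne_zero hη (left_ne_zero_of_mul hU)).le
  -- norms of the pieces
  have hφl2 : l2 φ φ ≤ l2 ψ ψ := l2_mul_le hψ fun U => Real.abs_sin_le_one _
  have hχl2 : l2 χ χ ≤ l2 ψ ψ := (l2_mul_le hφP fun U => Real.abs_sin_le_one _).trans hφl2
  have hl2ψ : 0 ≤ l2 ψ ψ := by unfold l2; exact integral_nonneg fun U => mul_self_nonneg _
  have hCE : 0 ≤ latCE L β := (latCE_pos hβ.le).le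
  have hEδ : 0 ≤ (Fintype.card (Edge 3 L) : ℝ) ^ 2 * (8 * π / δ) ^ 2 * (3 / β) * latCE L β := by positivity
  have hEη : 0 ≤ (Fintype.card (Edge 3 L) : ℝ) ^ 2 * (4 * π * Fintype.card (Plaquette 3 L) / η) ^ 2 * (3 / β) * latCE L β := by
    positivity
  have hC' : qform su2Rep β χ χ ≤ Real.exp (-(β * η)) * latCE L β * l2 ψ ψ :=
    hC.trans (mul_le_mul_of_nonneg_left hχl2 (by positivity))
  have hBerr : (1 / 2) * ((Fintype.card (Edge 3 L) : ℝ) ^ 2 * (4 * π * Fintype.card (Plaquette 3 L) / η) ^ 2 * (3 / β) * latCE L β) * l2 φ φ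
      ≤ (1 / 2) * ((Fintype.card (Edge 3 L) : ℝ) ^ 2 * (4 * π * Fintype.card (Plaquette 3 L) / η) ^ 2 * (3 / β) * latCE L β) * l2 ψ ψ :=
    mul_le_mul_of_nonneg_left hφl2 (by positivity)
  -- assemble
  have htot : qform su2Rep β ψ ψ ≤
      qform su2Rep β (fun U => Real.cos (innerPhase δ U) * ψ U) (fun U => Real.cos (innerPhase δ U) * ψ U)
      + (qform su2Rep β (fun U => Real.cos (actionPhase η U) * φ U) (fun U => Real.cos (actionPhase η U) * φ U)
          + Real.exp (-(β * η)) * latCE L β * l2 ψ ψ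
          + (1 / 2) * ((Fintype.card (Edge 3 L) : ℝ) ^ 2 * (4 * π * Fintype.card (Plaquette 3 L) / η) ^ 2 * (3 / β) * latCE L β) * l2 ψ ψ)
      + (1 / 2) * ((Fintype.card (Edge 3 L) : ℝ) ^ 2 * (8 * π / δ) ^ 2 * (3 / β) * latCE L β) * l2 ψ ψ := by
    have hB' : qform su2Rep β φ φ ≤ qform su2Rep β (fun U => Real.cos (actionPhase η U) * φ U) (fun U => Real.cos (actionPhase η U) * φ U)
        + Real.exp (-(β * η)) * latCE L β * l2 ψ ψ
        + (1 / 2) * ((Fintype.card (Edge 3 L) : ℝ) ^ 2 * (4 * π * Fintype.card (Plaquette 3 L) / η) ^ 2 * (3 / β) * latCE L β) * l2 ψ ψ := by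
      linarith [hB, hC', hBerr]
    linarith [hA, hB']
  refine htot.trans (le_of_eq ?_)
  ring

end Summit.QuantumFields.YangMills.Theorems.FemtoTransferGap

end
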